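import Summits.Ventures.Crystal3D.Theorems.StickyWulffConstantCoaxialWallLawDustDecoration
import Summits.Ventures.Crystal3D.Theorems.StickyWulffConstantCoaxialWallLawTailResidueDefs3
import HarnessLib

/-!
# Dust decoration for the LENS functional: the pool side of `TailTypeSoundnessL` is sound (no filler credit, exact two-payer clause)
# (crux `CoaxialWallLaw`, stmt-Ventures-19481; cf-p1 DECISION (cxi); T4 brick, census-free)

HONEST FRAMING. Venture `Summits/Ventures/Crystal3D` (cell `crystal3d-full`); helper `--supports` the crux `CoaxialWallLaw`
(stmt-Ventures-19481, `route-Ventures-StickyWulffConstant`), registered line 'CoaxialWallLawCertificates' (planner cf-p1).  Census-free;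
F-C1 not moved.  `…DustDecoration` (p693712) proved the decoration lemma for the CREDITED pools of Defs-I; memo F-TAIL-g9 §9 / (cxi) replaced
that functional by the credit-free LENS functional `localSummandFlatDecL` of `…TailResidueDefs3` (pools `pooledDefFlatDecL`, two-payer clause
`HasTwoPayersDecL` over EXACT deficient contacts).  This file proves the same lemma for it — which is exactly the soundness that failed before:
* `pooledDefFlatDecL_nonneg`, `one_le_pooledDefFlatDecL` (every pool of an exact ball is `≥ 1`, for ANY decoration);
* `pooledDefFlatDecL_le_pooledDef` — with the TRUE decoration `dustDeg X X₀`, the lens pool of `X₀` at `b` is at most the true pool of `X`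
  whenever `b` has two payers in `X` (a missing exact payer is a dust payer of deficiency `≥ 1`, covering the activation unit);
* **`localSummandA_le_localSummandFlatDecL_of_dust`** — removing the dust `X ∖ X₀` and recording its true degree decoration does not
  decrease the (A) summand at `z`, provided every (A)-end pair near `z` survives as a flat end pair of `X₀` (hypothesis `hD`, the frame side).
WHAT THIS IS NOT: not `hD`, not type soundness; F-C1 not moved.
-/

noncomputable section

namespace Summit.Ventures.Crystal3D.Theorems

open Summit.Ventures.Crystal3D Finset TailResidue
open scoped InnerProductSpace

section DustL

variable {X X₀ : Finset (EuclideanSpace ℝ (Fin 3))} {z : EuclideanSpace ℝ (Fin 3)} {δ : EuclideanSpace ℝ (Fin 3) → ℕ}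

open scoped Classical in
/-- Lens pools are non-negative. -/
theorem pooledDefFlatDecL_nonneg (b : EuclideanSpace ℝ (Fin 3)) : 0 ≤ pooledDefFlatDecL X₀ δ b := by
  unfold pooledDefFlatDecL
  refine add_nonneg (sum_nonneg fun y hy => ?_) (by split_ifs <;> norm_num)
  have : (degDec X₀ δ y : ℝ) ≤ 11 := by exact_mod_cast (mem_filter.1 hy).2.2
  linarith

open scoped Classical in
/-- **Every lens pool of an exact ball is `≥ 1`** (for any decoration). -/
theorem one_le_pooledDefFlatDecL {b : EuclideanSpace ℝ (Fin 3)} (hb : b ∈ X₀) : 1 ≤ pooledDefFlatDecL X₀ δ b := by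
  unfold pooledDefFlatDecL
  have hterm : ∀ y ∈ X₀.filter (fun y => dist b y ≤ 1 ∧ degDec X₀ δ y ≤ 11), (1 : ℝ) ≤ 12 - (degDec X₀ δ y : ℝ) := by
    intro y hy
    have : (degDec X₀ δ y : ℝ) ≤ 11 := by exact_mod_cast (mem_filter.1 hy).2.2
    linarith
  have hnn : 0 ≤ ∑ y ∈ X₀.filter (fun y => dist b y ≤ 1 ∧ degDec X₀ δ y ≤ 11), ((12 : ℝ) - (degDec X₀ δ y : ℝ)) :=
    sum_nonneg fun y hy => (zero_le_one.trans (hterm y hy))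
  split_ifs with h
  · rw [add_zero]
    rcases h with hdeg | htwo
    · -- `b` itself is a deficient exact payer
      have hbmem : b ∈ X₀.filter (fun y => dist b y ≤ 1 ∧ degDec X₀ δ y ≤ 11) := mem_filter.2 ⟨hb, by simp, hdeg⟩
      calc (1 : ℝ) ≤ 12 - (degDec X₀ δ b : ℝ) := hterm b hbmem
        _ ≤ _ := single_le_sum (fun y hy => zero_le_one.trans (hterm y hy)) hbmem
    · -- two deficient exact contacts
      obtain ⟨y, hy⟩ : (X₀.filter fun y => dist b y = 1 ∧ degDec X₀ δ y ≤ 11).Nonempty := by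
        rw [← card_pos]; omega
      obtain ⟨hy0, hd, hdeg⟩ := mem_filter.1 hy
      have hymem : y ∈ X₀.filter (fun y => dist b y ≤ 1 ∧ degDec X₀ δ y ≤ 11) := mem_filter.2 ⟨hy0, by rw [hd], hdeg⟩
      calc (1 : ℝ) ≤ 12 - (degDec X₀ δ y : ℝ) := hterm y hymem
        _ ≤ _ := single_le_sum (fun y hy => zero_le_one.trans (hterm y hy)) hymem
  · linarith

variable (hsub : X₀ ⊆ X)
include hsub

open scoped Classical in
/-- **Pools**: for `b` with two payers in `X`, the lens pool of `X₀` with the TRUE decoration is at most the true pool of `X`. -/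
theorem pooledDefFlatDecL_le_pooledDef {b : EuclideanSpace ℝ (Fin 3)} (hpay : HasTwoPayers X b) :
    pooledDefFlatDecL X₀ (dustDeg X X₀) b ≤ pooledDef X b := by
  unfold pooledDefFlatDecL pooledDef
  set P := X.filter (fun y => dist b y ≤ 1 ∧ (X.filter fun q => dist y q = 1).card ≤ 11) with hP
  set P₀ := X₀.filter (fun y => dist b y ≤ 1 ∧ degDec X₀ (dustDeg X X₀) y ≤ 11) with hP₀
  set P₁ := (X \ X₀).filter (fun x => dist b x ≤ 1 ∧ (X.filter fun q => dist x q = 1).card ≤ 11) with hP₁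
  have hunion : P₀ ∪ P₁ ⊆ P := by
    intro y hy
    rcases mem_union.1 hy with h | h
    · obtain ⟨hy0, hd, hdeg⟩ := mem_filter.1 h
      exact mem_filter.2 ⟨hsub hy0, hd, by rwa [degree_eq_degDec hsub]⟩
    · obtain ⟨hy1, hd, hdeg⟩ := mem_filter.1 h
      exact mem_filter.2 ⟨(mem_sdiff.1 hy1).1, hd, hdeg⟩
  have hdisj : Disjoint P₀ P₁ := by
    rw [disjoint_left]
    intro y hy hy'
    exact (mem_sdiff.1 (mem_filter.1 hy').1).2 (mem_filter.1 hy).1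
  have hterm : ∀ y ∈ P₀, ((12 : ℝ) - (degDec X₀ (dustDeg X X₀) y : ℝ)) = (12 : ℝ) - ((X.filter fun q => dist y q = 1).card : ℝ) := by
    intro y _; rw [degree_eq_degDec hsub]
  have hnn : ∀ y ∈ P, (0 : ℝ) ≤ 12 - ((X.filter fun q => dist y q = 1).card : ℝ) := by
    intro y hy
    have : ((X.filter fun q => dist y q = 1).card : ℝ) ≤ 11 := by exact_mod_cast (mem_filter.1 hy).2.2
    linarith
  have hsplit : (∑ y ∈ P₀, ((12 : ℝ) - (degDec X₀ (dustDeg X X₀) y : ℝ))) +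
      ∑ x ∈ P₁, ((12 : ℝ) - ((X.filter fun q => dist x q = 1).card : ℝ)) ≤
      ∑ y ∈ P, ((12 : ℝ) - ((X.filter fun q => dist y q = 1).card : ℝ)) := by
    rw [sum_congr rfl hterm, ← sum_union hdisj]
    exact sum_le_sum_of_subset_of_nonneg hunion fun y hy _ => hnn y hy
  have hP₁nn : 0 ≤ ∑ x ∈ P₁, ((12 : ℝ) - ((X.filter fun q => dist x q = 1).card : ℝ)) :=
    sum_nonneg fun x hx => hnn x (hunion (mem_union_right _ hx))
  split_ifs with hdec
  · linarith
  · -- the activation unit is covered by a deficient DUST payer touching `b`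
    have hone : (1 : ℝ) ≤ ∑ x ∈ P₁, ((12 : ℝ) - ((X.filter fun q => dist x q = 1).card : ℝ)) := by
      unfold HasTwoPayersDecL at hdec
      push Not at hdec
      obtain ⟨hdegb, hlt⟩ := hdec
      unfold HasTwoPayers at hpay
      rcases hpay with hdeg | ⟨z₁, hz₁, z₂, hz₂, hne, hd₁, hd₂, hc₁, hc₂⟩
      · exact absurd (by rwa [degree_eq_degDec hsub] at hdeg) (not_le.2 hdegb)
      · -- not both `z₁, z₂` are exact deficient contacts
        set A := X₀.filter (fun y => dist b y = 1 ∧ degDec X₀ (dustDeg X X₀) y ≤ 11) with hA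
        have hnot : z₁ ∉ X₀ ∨ z₂ ∉ X₀ := by
          by_contra hboth
          push Not at hboth
          have hsub2 : ({z₁, z₂} : Finset _) ⊆ A := by
            intro w hw
            rcases mem_insert.1 hw with rfl | hw
            · exact mem_filter.2 ⟨hboth.1, hd₁, by rwa [← degree_eq_degDec hsub]⟩
            · rw [mem_singleton] at hw; rw [hw]
              exact mem_filter.2 ⟨hboth.2, hd₂, by rwa [← degree_eq_degDec hsub]⟩
          have : 2 ≤ A.card := by
            calc 2 = ({z₁, z₂} : Finset _).card := by rw [card_pair hne]
              _ ≤ A.card := card_le_card hsub2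
          omega
        have hdust : ∀ w, w ∈ X → w ∉ X₀ → dist b w = 1 → (X.filter fun q => dist w q = 1).card ≤ 11 →
            (1 : ℝ) ≤ ∑ x ∈ P₁, ((12 : ℝ) - ((X.filter fun q => dist x q = 1).card : ℝ)) := by
          intro w hw hw0 hdw hcw
          have hwmem : w ∈ P₁ := mem_filter.2 ⟨mem_sdiff.2 ⟨hw, hw0⟩, by rw [hdw], hcw⟩
          have hcw' : ((X.filter fun q => dist w q = 1).card : ℝ) ≤ 11 := by exact_mod_cast hcw
          calc (1 : ℝ) ≤ 12 - ((X.filter fun q => dist w q = 1).card : ℝ) := by linarith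
            _ ≤ _ := single_le_sum (fun x hx => hnn x (hunion (mem_union_right _ hx))) hwmem
        rcases hnot with h1 | h2
        · exact hdust z₁ hz₁ h1 hd₁ hc₁
        · exact hdust z₂ hz₂ h2 hd₂ hc₂
    linarith

variable {v : WordVersion} {S₁ S₂ : PlateSystem} (hz : z ∈ X₀)
  (hD : ∀ b q : EuclideanSpace ℝ (Fin 3), dist z b ≤ 1 → IsEndPairA X v S₁ S₂ b q → IsEndPairFlat X₀ v S₁ S₂ b q)
include hD

include hz in
open scoped Classical in
/-- **DECORATION LEMMA for the LENS functional.**  Removing the dust `X ∖ X₀` and recording its true degree decoration does not decrease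
the (A) summand at `z`, provided every (A)-end pair near `z` survives as a flat end pair of `X₀`.  No filler credit is needed. -/
theorem localSummandA_le_localSummandFlatDecL_of_dust :
    localSummandA v S₁ S₂ X z ≤ localSummandFlatDecL v S₁ S₂ X₀ (dustDeg X X₀) z := by
  have _ := hz
  unfold localSummandA localSummandFlatDecL
  have hp : ∀ b, 0 ≤ pooledDefFlatDecL X₀ (dustDeg X X₀) b := fun b => pooledDefFlatDecL_nonneg b
  calc ∑ b ∈ X.filter (fun b => dist z b ≤ 1 ∧ 0 < endMultA X v S₁ S₂ b), (endMultA X v S₁ S₂ b : ℝ) / pooledDef X b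
      ≤ ∑ b ∈ X.filter (fun b => dist z b ≤ 1 ∧ 0 < endMultA X v S₁ S₂ b),
          (endMultFlat X₀ v S₁ S₂ b : ℝ) / pooledDefFlatDecL X₀ (dustDeg X X₀) b := by
        refine sum_le_sum fun b hb => ?_
        obtain ⟨hbX, hzb, hpos⟩ := mem_filter.1 hb
        have hb0 : b ∈ X₀ := mem_of_loaded hD hzb hpos
        have hpay : HasTwoPayers X b := by
          unfold endMultA at hpos
          obtain ⟨q, hq⟩ := card_pos.1 hpos
          exact (mem_filter.1 hq).2.2.2.1
        have hpd : pooledDefFlatDecL X₀ (dustDeg X X₀) b ≤ pooledDef X b := pooledDefFlatDecL_le_pooledDef hsub hpay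
        have hpd0 : 0 < pooledDefFlatDecL X₀ (dustDeg X X₀) b := lt_of_lt_of_le zero_lt_one (one_le_pooledDefFlatDecL hb0)
        calc (endMultA X v S₁ S₂ b : ℝ) / pooledDef X b
            ≤ (endMultA X v S₁ S₂ b : ℝ) / pooledDefFlatDecL X₀ (dustDeg X X₀) b :=
              div_le_div_of_nonneg_left (Nat.cast_nonneg _) hpd0 hpd
          _ ≤ (endMultFlat X₀ v S₁ S₂ b : ℝ) / pooledDefFlatDecL X₀ (dustDeg X X₀) b :=
              div_le_div_of_nonneg_right (by exact_mod_cast endMultA_le_endMultFlat_of_dust hD hzb) (hp b)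
    _ ≤ ∑ b ∈ X₀.filter (fun b => dist z b ≤ 1 ∧ 0 < endMultFlat X₀ v S₁ S₂ b),
          (endMultFlat X₀ v S₁ S₂ b : ℝ) / pooledDefFlatDecL X₀ (dustDeg X X₀) b := by
        refine sum_le_sum_of_subset_of_nonneg (fun b hb => ?_) fun b _ _ => div_nonneg (Nat.cast_nonneg _) (hp b)
        obtain ⟨hbX, hzb, hpos⟩ := mem_filter.1 hb
        exact mem_filter.2 ⟨mem_of_loaded hD hzb hpos, hzb,
          lt_of_lt_of_le hpos (endMultA_le_endMultFlat_of_dust hD hzb)⟩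

end DustL

end Summit.Ventures.Crystal3D.Theorems

end
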